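import Summits.QuantumFields.BalabanUV.Beta.GAN24.SrecUnits
import Summits.QuantumFields.BalabanUV.Beta.GAN24.StencilSlotOfShapes
import Summits.QuantumFields.BalabanUV.Beta.GAN24.RespStepBmDecompExact
import Summits.QuantumFields.BalabanUV.Beta.GAN24.Push3Nest
import Summits.QuantumFields.BalabanUV.Beta.GAN24.Push3LegTelescope

/-!
# `BalabanUV.Beta.GAN24.SrecWilsonSector` — binder row G-an2-4 / (CONV-C), CT-ROUTE (row owner's `gen19/CT3-MECHANISM-v1.2.md` §B ∕ §D (D1)):
# THE IDENTIFICATION STEP (E-α-W) — the CUBIC-WILSON SECTOR of leaf-10's recursive family `SrecAt`, member `k+1`, in the adopted units, IS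
# `(cE·(cE·Lc^{2(d+1)})^{k+1}) • push₃ T T T (wilsonA d)` with the dressed leg chain `T = legChain (respStepBmSeq ρ Lc) 0 k` in all three slots

NOT IN PRINT; OUR BOOKKEEPING (G-an2-4 formalisation swarm → CRUX TEAM (2), leaf seat `b2b-balaban-gan24-formalise-leaf-03`, gen 52; the owner's OFFER
«(E-α-W) → leaf-03 or leaf-01 — say MINE» (journal `CLAIMS.log` l.31770), MINE l.31821).  [folklore] bookkeeping over tree theorems BY NAME: the owner's g12
`SrecUnits.unitS_cubicPiece_eq` (units: the level weight `cE·wE (j+1)` becomes the j-FREE `cE·Lc^{2(d+1)}`), asym1's `unitK_coDressKBmAt` (units commute with the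
co-dressing), leaf-01's `SrecLinearPartEq.e3K_eq_neg_push₃_of_isFF` (the third jet of an ff-valued family is ONE three-leg push), leaf-01 g43's `RespStepBm`
leg dictionary (`rowM ∕ colH` of the co-dressed unit step resolvent `= ∓respStepBm`), leaf-01's `Push3Nest.transport_push₃` (k pushes = one push through the
leg chains) and `Push3.push₃_smul` ∕ `Push3LegTelescope.push₃_neg_left`, lit `StepJetData.locStencil_wilsonA`; ONE bookkeeping `def` (`wilsonSecAt`, asserting
nothing) + `bornSecAt` (a pointwise difference); 0 cited facts, 0 `def … : Prop`, 0 sorry.  HONEST FRAMING (cell contract, verbatim): «discharging `BetaPertH` makes Bałaban's UV stability UNCONDITIONAL — a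
real constructive-QFT result; it is NOT the continuum limit and NOT the Clay problem.»  HONEST DEPENDENCY (verbatim): «continuum YM on T⁴ ⇐ BetaPertH ∧ nine spine
estimates (0/9 proved); BetaPertH ⇐ (D1) ∧ (D4) ∧ CAP+tail; G-an2-4 gates asym, D1 and NE2/3/4.»

## What (generic `d`; `Lc` with `[NeZero Lc]`; in-block root `ρ = toSite rr`, `rr ∈ box (d+1) Lc` where stated)
* §1 `wilsonSecAt ρ cE : ℕ → (stencil family)` — the CUBIC-WILSON LINEAGE of `WardLocusRecursive.SrecAt`: member `0` = `cE • wilsonA d` (the first summand of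
  `SpineRootedS0N.S0NAt`), member `j+1` = `(cE·wE (j+1)) • e3OfK Lc (coDressKBmAt ρ Lc (KInvStep Lc j)) (member j)` (the first summand of `SrecAt_succ` with the
  previous WILSON member in the table slot — the VH∕Λ-born sectors of v1.2 §D (D2) are exactly what is left out); `isFF_wilsonSecAt` (ff-valued), `isFF_unitS`.
* §2 **`unitS_wilsonSecAt_succ`** (one step in units: `unitS_{j+1} W_{j+1} = (cE·Lc^{2(d+1)}) • e3K (coDressKBmAt ρ Lc K̃_j) Lc
  (unitS_j W_j)`, `K̃_j = KStepUnit Lc j`), **`e3K_coDressKBmAt_KStepUnit_of_isFF`** (for an ff-valued family the co-dressed third jet IS `push₃ R_j R_j R_j`,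
  `R_j = respStepBmSeq ρ Lc j` — the two signs `rowM = −R_j` and `e3K = −push₃` cancel).
* §3 **`unitS_wilsonSecAt_succ_eq_transport`** (induction: `unitS_{k+1} W_{k+1} = (cE·c₃^{k+1}) • transport (push₃ R_j R_j R_j) 0 (k+1) (wilsonA d)`, `c₃ = cE·Lc^{2(d+1)}`)
  and the END **`unitS_wilsonSecAt_succ_eq_push₃`**: `unitS (sfStep Lc (k+1)) (smStep d Lc (k+1)) (wilsonSecAt (toSite rr) cE (k+1))
  = fun κ′ u′ => (cE·(cE·Lc^{2(d+1)})^{k+1}) • push₃ T T T (wilsonA d) κ′ u′`, `T = legChain (respStepBmSeq (toSite rr) Lc) 0 k` — hypotheses `[NeZero Lc]`,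
  `rr ∈ box (d+1) Lc` ONLY; every `k`; sign `+`.  The socket for CT-3c's END (`ContactKernelCells.contact_legChain_ff_eq_cells` at `m = 0`, leaf-01 g58) on the
  cubic-Wilson sector of the literal (E).
* §4 `locStencil_wilsonSecAt` (every member local, in-block root); `bornSecAt := SrecAt − wilsonSecAt` (the sectors BORN from `vhSAt` ∕ the Λ-piece),
  `SrecAt_eq_wilsonSecAt_add_bornSecAt`, `locStencil_bornSecAt`, and **`bornSecAt_succ`** — the remainder obeys the DECOUPLED recursion (its cubic line reads the
  remainder only; sources = the fresh border and Λ sectors; additivity of the cubic functional on local families, leaf-01's `SrecLinearPartEq.e3K_add`):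
  the Wilson lineage decouples from the rest of (E)'s recursion (the owner's v1.2 §D (D2) objects, as a recursion).
Discharges NO slot letter; asserts NO shape of Bałaban's stencils; 0 wall binders; NEVER «G-an2-4 closed»; NOT D1, NOT BetaPertH, NOT continuum, NOT Clay.
-/

noncomputable section

open Finset
open scoped BigOperators
open Literature.MathematicalPhysics.QuantumFieldTheory
open Literature.MathematicalPhysics.QuantumFieldTheory.Balaban1983to89
open Literature.MathematicalPhysics.QuantumFieldTheory.Balaban1983to89.Beta
open ExpKernelCalculus (MKer Decays)
open AffineAveraging (box toSite)
open OneStepResolventKernel (Fib LocStencil)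
open OneStepKernelFamily (KInvStep decays_KInvStep colH)
open BalabanStepJetsSucc (wE wVH wΛ E2 lamCoeffK mmRead)
open StepJetData (wilsonA wBound locStencil_wilsonA locStencil_add locStencil_smul)
open BalabanStepJets (locStencil_mono)
open AveragingHessianKernelsRooted (vhSAt hessFFAt)
open InterLevelTransport (SLam)
open Summit.QuantumFields.BalabanUV.Beta.HessKerDressedUnits (unitK unitS unitS_apply decays_unitK)
open Summit.QuantumFields.BalabanUV.Beta.GAN24.CombesThomas (sfStep smStep sfStep_ne_zero smStep_ne_zero KStepUnit)
open Summit.QuantumFields.BalabanUV.Beta.GAN24.ThirdJetKernel (e3K)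
open Summit.QuantumFields.BalabanUV.Beta.AxialDressingRooted (coDressKBmAt one_le_of_neZero decays_coDressKBmAt_KInvStep)
open Summit.QuantumFields.BalabanUV.Beta.HessKerCoDressedBmWall (unitK_coDressKBmAt)
open Summit.QuantumFields.BalabanUV.Beta.SpineRooted (e3OfK e3OfK_apply locStencil_e3OfK S0NAt)
open Summit.QuantumFields.BalabanUV.Beta.WardLocusRecursive (SrecAt SrecAt_zero SrecAt_succ locStencil_SrecAt)
open Summit.QuantumFields.BalabanUV.Beta.GAN24.CubicReadoutDecLift (e3OfK_eq_e3K)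
open Summit.QuantumFields.BalabanUV.Beta.GAN24.SrecUnits (unitS_cubicPiece_eq KStepUnit_eq)
open Summit.QuantumFields.BalabanUV.Beta.GAN24.StencilSlotOfShapes (unitS_step_zero)
open Summit.QuantumFields.BalabanUV.Beta.GAN24.Push4 (rowM IsFF isFF_mmRead)
open Summit.QuantumFields.BalabanUV.Beta.GAN24.Push4Bounds (LegDecay)
open Summit.QuantumFields.BalabanUV.Beta.GAN24.Push4Iter (LegFam legChain)
open Summit.QuantumFields.BalabanUV.Beta.GAN24.Push3 (push₃ push₃_smul isFF_push₃)
open Summit.QuantumFields.BalabanUV.Beta.GAN24.Push3LegTelescope (push₃_neg_left)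
open Summit.QuantumFields.BalabanUV.Beta.GAN24.AffineUnroll (transport transport_zero transport_succ)
open Summit.QuantumFields.BalabanUV.Beta.GAN24.Push3Nest (transport_push₃)
open Summit.QuantumFields.BalabanUV.Beta.GAN24.SrecLinearPartEq (e3K_eq_neg_push₃_of_isFF e3K_add)
open Summit.QuantumFields.BalabanUV.Beta.GAN24.RespStepBm (respStepBm rowM_coDressKBmAt_KStepUnit colH_coDressKBmAt_KStepUnit
  legDecay_respStepBm_of_decays)
open Summit.QuantumFields.BalabanUV.Beta.GAN24.RespStepBmDecompExact (respStepBmSeq respStepBmSeq_apply)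

namespace Summit.QuantumFields.BalabanUV.Beta.GAN24.SrecWilsonSector

variable {d : ℕ} {Lc : ℕ} [NeZero Lc]

/-! ## §1 The cubic-Wilson lineage of `SrecAt` -/

section Defs

variable (Lc)

/-- [our object — bookkeeping, asserting nothing] **THE CUBIC-WILSON LINEAGE OF THE RECURSIVE FAMILY**: member `0` is `cE • wilsonA d` (the first summand of
`SpineRootedS0N.S0NAt`), member `j+1` is `(cE·wE (j+1)) • e3OfK Lc (coDressKBmAt ρ Lc (KInvStep Lc j)) (member j)` — the first summand of
`WardLocusRecursive.SrecAt_succ` with the previous WILSON member in the table slot (the sectors born from `vhSAt` ∕ the Λ-piece at later levels are left out). -/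
def wilsonSecAt (ρ : Fin (d + 1) → ℤ) (cE : ℝ) : ℕ → Fin (d + 1) → (Fin (d + 1) → ℤ) → MKer (d + 1) (Fib d)
  | 0 => fun κ' u' => cE • wilsonA d κ' u'
  | j + 1 => fun κ' u' => (cE * wE d Lc (j + 1)) • e3OfK Lc (coDressKBmAt ρ Lc (KInvStep (d := d) Lc j)) (wilsonSecAt ρ cE j) κ' u'

variable {Lc}

/-- [folklore] Member `0`, by `rfl`. -/
@[simp] theorem wilsonSecAt_zero (ρ : Fin (d + 1) → ℤ) (cE : ℝ) : wilsonSecAt Lc ρ cE 0 = fun κ' u' => cE • wilsonA d κ' u' := rfl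

/-- [folklore] The recursion step (unfolding lemma). -/
theorem wilsonSecAt_succ (ρ : Fin (d + 1) → ℤ) (cE : ℝ) (j : ℕ) :
    wilsonSecAt Lc ρ cE (j + 1) = fun κ' u' =>
      (cE * wE d Lc (j + 1)) • e3OfK Lc (coDressKBmAt ρ Lc (KInvStep (d := d) Lc j)) (wilsonSecAt Lc ρ cE j) κ' u' := rfl

end Defs

/-- [folklore] `wilsonA d κ′ u′` is ff-valued (its three multiplier blocks are `0` by definition). -/
theorem isFF_wilsonA (κ' : Fin (d + 1)) (u' : Fin (d + 1) → ℤ) : IsFF (wilsonA d κ' u') := by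
  refine ⟨fun x z μ b => ?_, fun x z a ν => ?_⟩
  · rcases b with β | ν <;> rfl
  · rcases a with α | μ <;> rfl

/-- [folklore] A scalar multiple of an ff-valued kernel is ff-valued. -/
theorem isFF_smul {V : MKer (d + 1) (Fib d)} (hV : IsFF V) (c : ℝ) : IsFF (c • V) :=
  ⟨fun x z μ b => by rw [Pi.smul_apply, Pi.smul_apply, Pi.smul_apply, Pi.smul_apply, hV.1, smul_zero],
    fun x z a ν => by rw [Pi.smul_apply, Pi.smul_apply, Pi.smul_apply, Pi.smul_apply, hV.2, smul_zero]⟩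

/-- [folklore] **EVERY MEMBER OF THE WILSON LINEAGE IS ff-VALUED** (member `0`: `wilsonA`; member `j+1`: `e3OfK … = −mmRead …`, `Push4.isFF_mmRead`). -/
theorem isFF_wilsonSecAt (ρ : Fin (d + 1) → ℤ) (cE : ℝ) : ∀ (j : ℕ) (κ' : Fin (d + 1)) (u' : Fin (d + 1) → ℤ), IsFF (wilsonSecAt Lc ρ cE j κ' u')
  | 0, κ', u' => isFF_smul (isFF_wilsonA κ' u') cE
  | j + 1, κ', u' => by
    rw [wilsonSecAt_succ]
    refine isFF_smul ⟨fun x z μ b => ?_, fun x z a ν => ?_⟩ _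
    · rw [e3OfK_apply, (isFF_mmRead _ _).1, neg_zero]
    · rw [e3OfK_apply, (isFF_mmRead _ _).2, neg_zero]

/-- [folklore] The change of units preserves ff-valuedness. -/
theorem isFF_unitS {S : Fin (d + 1) → (Fin (d + 1) → ℤ) → MKer (d + 1) (Fib d)} (hS : ∀ κ u, IsFF (S κ u)) (sf sm : ℝ)
    (κ : Fin (d + 1)) (u : Fin (d + 1) → ℤ) : IsFF (unitS sf sm S κ u) :=
  ⟨fun x z μ b => by rw [unitS_apply, (hS κ u).1, mul_zero, zero_mul, mul_zero],
    fun x z a ν => by rw [unitS_apply, (hS κ u).2, mul_zero, zero_mul, mul_zero]⟩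

/-! ## §2 One step in the adopted units; the co-dressed third jet of an ff-valued family is one push through `R_j` -/

/-- [folklore] **ONE STEP OF THE WILSON LINEAGE IN THE ADOPTED UNITS**: `unitS_{j+1} W_{j+1} = (cE·Lc^{2(d+1)}) • e3K (coDressKBmAt ρ Lc K̃_j) Lc (unitS_j W_j)`,
`K̃_j = KStepUnit Lc j` (the owner's `SrecUnits.unitS_cubicPiece_eq` — the weight `cE·wE (j+1)` against the units is the j-FREE `cE·Lc^{2(d+1)}` — and asym1's
`unitK_coDressKBmAt`: rescaling commutes with the co-dressing). No locality hypothesis. -/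
theorem unitS_wilsonSecAt_succ (ρ : Fin (d + 1) → ℤ) (cE : ℝ) (j : ℕ) :
    unitS (sfStep Lc (j + 1)) (smStep d Lc (j + 1)) (wilsonSecAt Lc ρ cE (j + 1))
      = fun κ' u' => (cE * (Lc : ℝ) ^ (2 * (d + 1))) •
          e3K (coDressKBmAt ρ Lc (KStepUnit (d := d) Lc j)) Lc (unitS (sfStep Lc j) (smStep d Lc j) (wilsonSecAt Lc ρ cE j)) κ' u' := by
  have hsfj : sfStep Lc j ≠ 0 := sfStep_ne_zero j
  have hsmj : smStep d Lc j ≠ 0 := smStep_ne_zero (d := d) j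
  have e : wilsonSecAt Lc ρ cE (j + 1)
      = fun κ' u' => (cE * wE d Lc (j + 1)) • e3K (coDressKBmAt ρ Lc (KInvStep (d := d) Lc j)) Lc (wilsonSecAt Lc ρ cE j) κ' u' := by
    funext κ' u'
    show (cE * wE d Lc (j + 1)) • e3OfK Lc (coDressKBmAt ρ Lc (KInvStep (d := d) Lc j)) (wilsonSecAt Lc ρ cE j) κ' u' = _
    rw [e3OfK_eq_e3K]
  rw [e, unitS_cubicPiece_eq cE j, unitK_coDressKBmAt ρ Lc hsfj hsmj (KInvStep (d := d) Lc j), ← KStepUnit_eq]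

/-- [folklore] **FOR AN ff-VALUED FAMILY THE THIRD JET THROUGH THE CO-DRESSED UNIT STEP RESOLVENT IS ONE THREE-LEG PUSH THROUGH THE DRESSED RESPONSE
FAMILY `R_j = respStepBmSeq ρ Lc j` IN ALL THREE SLOTS** — hypothesis-free in the family: `e3K (coDressKBmAt ρ Lc K̃_j) Lc S κ′ u′ = push₃ R_j R_j R_j S κ′ u′`
(`e3K_eq_neg_push₃_of_isFF`: `e3K K = −push₃ (rowM K) (colH K) (colH K)`; leaf-01 g43's `rowM_coDressKBmAt_KStepUnit = −R_j`, `colH_coDressKBmAt_KStepUnit = R_j`;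
the two signs cancel by `push₃_neg_left`). -/
theorem e3K_coDressKBmAt_KStepUnit_of_isFF (ρ : Fin (d + 1) → ℤ) (j : ℕ) {S : Fin (d + 1) → (Fin (d + 1) → ℤ) → MKer (d + 1) (Fib d)}
    (hS : ∀ κ u, IsFF (S κ u)) (κ' : Fin (d + 1)) (u' : Fin (d + 1) → ℤ) :
    e3K (coDressKBmAt ρ Lc (KStepUnit (d := d) Lc j)) Lc S κ' u'
      = push₃ (respStepBmSeq ρ Lc j) (respStepBmSeq ρ Lc j) (respStepBmSeq ρ Lc j) S κ' u' := by
  rw [e3K_eq_neg_push₃_of_isFF _ Lc hS κ' u', rowM_coDressKBmAt_KStepUnit, colH_coDressKBmAt_KStepUnit, respStepBmSeq_apply,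
    push₃_neg_left, neg_neg]

/-! ## §3 The identification: k+1 steps = ONE three-leg push through the dressed leg chains -/

/-- [folklore] **ONE STEP = ONE PUSH, IN UNITS**: `unitS_{j+1} W_{j+1} = fun κ′ u′ ↦ (cE·Lc^{2(d+1)}) • push₃ R_j R_j R_j (unitS_j W_j) κ′ u′` (§2's two lemmas;
the lineage is ff-valued). Hypothesis-free. -/
theorem unitS_wilsonSecAt_succ_eq_push₃_step (ρ : Fin (d + 1) → ℤ) (cE : ℝ) (j : ℕ) :
    unitS (sfStep Lc (j + 1)) (smStep d Lc (j + 1)) (wilsonSecAt Lc ρ cE (j + 1))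
      = fun κ' u' => (cE * (Lc : ℝ) ^ (2 * (d + 1))) •
          push₃ (respStepBmSeq ρ Lc j) (respStepBmSeq ρ Lc j) (respStepBmSeq ρ Lc j)
            (unitS (sfStep Lc j) (smStep d Lc j) (wilsonSecAt Lc ρ cE j)) κ' u' := by
  rw [unitS_wilsonSecAt_succ]
  funext κ' u'
  show (cE * (Lc : ℝ) ^ (2 * (d + 1))) •
      e3K (coDressKBmAt ρ Lc (KStepUnit (d := d) Lc j)) Lc (unitS (sfStep Lc j) (smStep d Lc j) (wilsonSecAt Lc ρ cE j)) κ' u' = _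
  rw [e3K_coDressKBmAt_KStepUnit_of_isFF ρ j
    (isFF_unitS (isFF_wilsonSecAt (Lc := Lc) ρ cE j) (sfStep Lc j) (smStep d Lc j)) κ' u']

/-- [folklore] **THE WILSON LINEAGE IN UNITS IS THE k-FOLD TRANSPORT OF `wilsonA` BY THE PUSHES `push₃ R_j R_j R_j`** (hypothesis-free; induction on `k`,
`push₃_smul` pulling the j-FREE weight `c₃ = cE·Lc^{2(d+1)}` and member `0`'s `cE` out of the table slot):
`unitS_{k+1} W_{k+1} = (cE·c₃^{k+1}) • transport (fun j T ↦ push₃ R_j R_j R_j T) 0 (k+1) (wilsonA d)`. -/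
theorem unitS_wilsonSecAt_succ_eq_transport (ρ : Fin (d + 1) → ℤ) (cE : ℝ) :
    ∀ k : ℕ, unitS (sfStep Lc (k + 1)) (smStep d Lc (k + 1)) (wilsonSecAt Lc ρ cE (k + 1))
      = fun κ' u' => (cE * (cE * (Lc : ℝ) ^ (2 * (d + 1))) ^ (k + 1)) •
          transport (fun j T => push₃ (respStepBmSeq ρ Lc j) (respStepBmSeq ρ Lc j) (respStepBmSeq ρ Lc j) T) 0 (k + 1) (wilsonA d) κ' u'
  | 0 => by
    rw [unitS_wilsonSecAt_succ_eq_push₃_step, unitS_step_zero, wilsonSecAt_zero]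
    funext κ' u'
    show (cE * (Lc : ℝ) ^ (2 * (d + 1))) •
        push₃ (respStepBmSeq ρ Lc 0) (respStepBmSeq ρ Lc 0) (respStepBmSeq ρ Lc 0) (fun κ u => cE • wilsonA d κ u) κ' u' = _
    rw [push₃_smul, smul_smul]
    simp only [transport_succ, transport_zero, Nat.zero_add]
    congr 1
    ring
  | k + 1 => by
    rw [unitS_wilsonSecAt_succ_eq_push₃_step, unitS_wilsonSecAt_succ_eq_transport ρ cE k]
    funext κ' u'
    show (cE * (Lc : ℝ) ^ (2 * (d + 1))) •
        push₃ (respStepBmSeq ρ Lc (k + 1)) (respStepBmSeq ρ Lc (k + 1)) (respStepBmSeq ρ Lc (k + 1))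
          (fun κ u => (cE * (cE * (Lc : ℝ) ^ (2 * (d + 1))) ^ (k + 1)) •
            transport (fun j T => push₃ (respStepBmSeq ρ Lc j) (respStepBmSeq ρ Lc j) (respStepBmSeq ρ Lc j) T) 0 (k + 1) (wilsonA d) κ u)
          κ' u' = _
    rw [push₃_smul, smul_smul]
    simp only [transport_succ, Nat.zero_add]
    congr 1
    ring

/-- [folklore] **LEVELWISE LOCALISATION OF THE DRESSED RESPONSE FAMILIES** (in-block root): every `R_j = respStepBmSeq (toSite rr) Lc j` satisfies
`∃ C m, 0 < m ∧ LegDecay R_j Lc C m` (an2's `decays_KInvStep` → `decays_unitK` → leaf-01 g43's `legDecay_respStepBm_of_decays`) — the hypothesis shape of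
`Push3Nest.transport_push₃` ∕ `Push4Iter.legDecay_legChain`. -/
theorem legDecay_respStepBmSeq {rr : Fin (d + 1) → ℕ} (hrr : rr ∈ box (d + 1) Lc) (j : ℕ) :
    ∃ C m : ℝ, 0 < m ∧ LegDecay (respStepBmSeq (toSite rr) Lc j) Lc C m := by
  obtain ⟨δK, CK, hδK, -, hK⟩ := decays_KInvStep (d := d) (Lc := Lc) j
  have hKu : Decays (KStepUnit (d := d) Lc j) (max |sfStep Lc j| |smStep d Lc j| * CK * max |sfStep Lc j| |smStep d Lc j|) δK := by
    rw [KStepUnit_eq]; exact decays_unitK hK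
  exact ⟨_, δK, hδK, legDecay_respStepBm_of_decays (one_le_of_neZero Lc) hrr hKu hδK.le⟩

/-- NOT IN PRINT; OUR BOOKKEEPING ((E-α-W) of the row owner's `CT3-MECHANISM-v1.2.md` §B ∕ §D (D1); [folklore]).
**THE CUBIC-WILSON SECTOR OF THE RECURSIVE FAMILY, MEMBER `k+1`, IN THE ADOPTED UNITS, IS ONE THREE-LEG PUSH OF `wilsonA` THROUGH THE DRESSED LEG CHAIN
IN ALL THREE SLOTS**: for an in-block root `toSite rr` and every `k`,
`unitS (sfStep Lc (k+1)) (smStep d Lc (k+1)) (wilsonSecAt (toSite rr) cE (k+1)) = fun κ′ u′ ↦ (cE·(cE·Lc^{2(d+1)})^{k+1}) • push₃ T T T (wilsonA d) κ′ u′`,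
`T = legChain (respStepBmSeq (toSite rr) Lc) 0 k` (§3's transport form + leaf-01's `Push3Nest.transport_push₃`, levelwise localisation `legDecay_respStepBmSeq`,
table locality lit `locStencil_wilsonA`).  The legs `T` and the table `wilsonA d` are EXACTLY those of leaf-01 g58's `ContactKernelCells.contact_legChain_ff_eq_cells`
at `m = 0`; the weight is j-free per level; sign `+`. -/
theorem unitS_wilsonSecAt_succ_eq_push₃ {rr : Fin (d + 1) → ℕ} (hrr : rr ∈ box (d + 1) Lc) (cE : ℝ) (k : ℕ) :
    unitS (sfStep Lc (k + 1)) (smStep d Lc (k + 1)) (wilsonSecAt Lc (toSite rr) cE (k + 1))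
      = fun κ' u' => (cE * (cE * (Lc : ℝ) ^ (2 * (d + 1))) ^ (k + 1)) •
          push₃ (legChain (respStepBmSeq (toSite rr) Lc) 0 k) (legChain (respStepBmSeq (toSite rr) Lc) 0 k)
            (legChain (respStepBmSeq (toSite rr) Lc) 0 k) (wilsonA d) κ' u' := by
  have hS : ∃ C δ : ℝ, 0 < δ ∧ LocStencil (wilsonA d) C δ := ⟨_, 1, one_pos, locStencil_wilsonA (d := d) zero_le_one⟩
  rw [unitS_wilsonSecAt_succ_eq_transport,
    transport_push₃ (one_le_of_neZero Lc) (legDecay_respStepBmSeq hrr) (legDecay_respStepBmSeq hrr) (legDecay_respStepBmSeq hrr) hS 0 k]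

/-! ## §4 Locality of the lineage; the remainder of `SrecAt` obeys the DECOUPLED recursion (driven by the VH∕Λ sources only) -/

/-- [folklore] **EVERY MEMBER OF THE WILSON LINEAGE IS A LOCAL STENCIL FAMILY** (in-block root): member `0` by lit `locStencil_wilsonA`, member `j+1` by an2's
`locStencil_e3OfK` (decay of `coDressKBmAt ρ Lc (KInvStep Lc j)`: `decays_coDressKBmAt_KInvStep`) — the same two bricks as leaf-10's `locStencil_SrecAt`. -/
theorem locStencil_wilsonSecAt {rr : Fin (d + 1) → ℕ} (hrr : rr ∈ box (d + 1) Lc) (cE : ℝ) :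
    ∀ j : ℕ, ∃ Cs δ : ℝ, 0 < δ ∧ LocStencil (wilsonSecAt Lc (toSite rr) cE j) Cs δ
  | 0 => ⟨_, 1, one_pos, locStencil_smul cE (locStencil_wilsonA (d := d) zero_le_one)⟩
  | j + 1 => by
    obtain ⟨Cs, δ, hδ, hW⟩ := locStencil_wilsonSecAt hrr cE j
    obtain ⟨C₁, δ₁, hδ₁, h1⟩ := locStencil_e3OfK (N := Lc) (one_le_of_neZero Lc) (decays_coDressKBmAt_KInvStep (d := d) hrr j) hW hδ
    exact ⟨_, δ₁, hδ₁, locStencil_smul _ h1⟩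

section Born

variable (Lc)

/-- [our object — bookkeeping, asserting nothing] **THE REMAINDER OF THE RECURSIVE FAMILY BESIDE ITS WILSON LINEAGE**:
`bornSecAt ρ cE cVH cΛ j := SrecAt … j − wilsonSecAt ρ cE j` (pointwise) — the sectors BORN from `vhSAt` and the Λ-piece at the levels `≤ j` and pushed on
(the owner's v1.2 §D (D2) objects). -/
def bornSecAt (ρ : Fin (d + 1) → ℤ) (cE cVH cΛ : ℝ) (j : ℕ) : Fin (d + 1) → (Fin (d + 1) → ℤ) → MKer (d + 1) (Fib d) :=
  fun κ' u' => SrecAt d Lc ρ cE cVH cΛ j κ' u' - wilsonSecAt Lc ρ cE j κ' u'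

variable {Lc}

/-- [folklore] **THE RECURSIVE FAMILY IS ITS WILSON LINEAGE PLUS THE REMAINDER** (by definition of the remainder). -/
theorem SrecAt_eq_wilsonSecAt_add_bornSecAt (ρ : Fin (d + 1) → ℤ) (cE cVH cΛ : ℝ) (j : ℕ) :
    SrecAt d Lc ρ cE cVH cΛ j = fun κ' u' => wilsonSecAt Lc ρ cE j κ' u' + bornSecAt Lc ρ cE cVH cΛ j κ' u' := by
  funext κ' u'; simp only [bornSecAt, add_sub_cancel]

/-- [folklore] Member `0` of the remainder: the border and Λ sectors of the native spine `S0NAt` (its `cE • wilsonA` summand removed). -/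
theorem bornSecAt_zero (ρ : Fin (d + 1) → ℤ) (cE cVH cΛ : ℝ) :
    bornSecAt Lc ρ cE cVH cΛ 0 = fun κ' u' => S0NAt d Lc ρ cE cVH cΛ κ' u' - cE • wilsonA d κ' u' := rfl

/-- [folklore] The remainder is a local stencil family (in-block root): `SrecAt` (leaf-10's `locStencil_SrecAt`) minus the Wilson lineage (`locStencil_wilsonSecAt`). -/
theorem locStencil_bornSecAt {rr : Fin (d + 1) → ℕ} (hrr : rr ∈ box (d + 1) Lc) (cE cVH cΛ : ℝ) (j : ℕ) :
    ∃ Cs δ : ℝ, 0 < δ ∧ LocStencil (bornSecAt Lc (toSite rr) cE cVH cΛ j) Cs δ := by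
  obtain ⟨Cs, δs, hδs, hS⟩ := locStencil_SrecAt (d := d) (Lc := Lc) (one_le_of_neZero Lc) hrr cE cVH cΛ j
  obtain ⟨Cw, δw, hδw, hW⟩ := locStencil_wilsonSecAt hrr cE j
  have hCs : 0 ≤ Cs := (hS 0 0).nonneg (Sum.inl 0)
  have hCw : 0 ≤ Cw := (hW 0 0).nonneg (Sum.inl 0)
  refine ⟨Cs + |(-1 : ℝ)| * Cw, min δs δw, lt_min hδs hδw, ?_⟩
  have h := locStencil_add (locStencil_mono hS hCs (min_le_left δs δw)) (locStencil_smul (-1) (locStencil_mono hW hCw (min_le_right δs δw)))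
  refine fun κ' u' => ?_
  have e : bornSecAt Lc (toSite rr) cE cVH cΛ j κ' u'
      = SrecAt d Lc (toSite rr) cE cVH cΛ j κ' u' + (-1 : ℝ) • wilsonSecAt Lc (toSite rr) cE j κ' u' := by
    simp only [bornSecAt, neg_one_smul, sub_eq_add_neg]
  rw [e]
  exact h κ' u'

/-- NOT IN PRINT; OUR BOOKKEEPING ([folklore]; the owner's v1.2 §D (D2) «VH∕Λ-born sectors», made a recursion).
**THE REMAINDER OBEYS THE DECOUPLED RECURSION — ITS CUBIC LINE READS THE REMAINDER ONLY, THE SOURCES ARE THE FRESH BORDER AND Λ SECTORS**: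
`bornSecAt (j+1) = (cE·wE (j+1)) • e3OfK Lc (coDressKBmAt ρ Lc (KInvStep Lc j)) (bornSecAt j) + (cVH·wVH (j+1)) • vhSAt ρ + (cΛ·wΛ (j+1)) • SLam Lc (lamCoeffK K_{j+1} E2_{j+1} Lc) (hessFFAt ρ)`
(in-block root; `WardLocusRecursive.SrecAt_succ` minus `wilsonSecAt_succ`, the cubic functional being ADDITIVE on local families — leaf-01's `SrecLinearPartEq.e3K_add`
with an2's `decays_coDressKBmAt_KInvStep`, `locStencil_wilsonSecAt`, `locStencil_bornSecAt`).  So the Wilson lineage DECOUPLES from the rest of (E)'s recursion. -/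
theorem bornSecAt_succ {rr : Fin (d + 1) → ℕ} (hrr : rr ∈ box (d + 1) Lc) (cE cVH cΛ : ℝ) (j : ℕ) :
    bornSecAt Lc (toSite rr) cE cVH cΛ (j + 1) = fun κ' u' =>
      (cE * wE d Lc (j + 1)) • e3OfK Lc (coDressKBmAt (toSite rr) Lc (KInvStep (d := d) Lc j)) (bornSecAt Lc (toSite rr) cE cVH cΛ j) κ' u' +
        (cVH * wVH d Lc (j + 1)) • vhSAt (toSite rr) d Lc rfl κ' u' +
        (cΛ * wΛ d Lc (j + 1)) •
          SLam Lc (lamCoeffK (KInvStep (d := d) Lc (j + 1)) (E2 d Lc (j + 1)) Lc) (fun μ y => hessFFAt (toSite rr) Lc μ y) κ' u' := by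
  obtain ⟨δG, CG, hδG, -, hG⟩ := decays_coDressKBmAt_KInvStep (d := d) hrr j
  obtain ⟨Cw, δw, hδw, hW⟩ := locStencil_wilsonSecAt hrr cE j
  obtain ⟨Cb, δb, hδb, hB⟩ := locStencil_bornSecAt hrr cE cVH cΛ j
  -- the cubic functional of member `j` splits along `SrecAt j = wilsonSecAt j + bornSecAt j`
  have hsplit : ∀ κ' u', e3OfK Lc (coDressKBmAt (toSite rr) Lc (KInvStep (d := d) Lc j)) (SrecAt d Lc (toSite rr) cE cVH cΛ j) κ' u'
      = e3OfK Lc (coDressKBmAt (toSite rr) Lc (KInvStep (d := d) Lc j)) (wilsonSecAt Lc (toSite rr) cE j) κ' u'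
        + e3OfK Lc (coDressKBmAt (toSite rr) Lc (KInvStep (d := d) Lc j)) (bornSecAt Lc (toSite rr) cE cVH cΛ j) κ' u' := by
    intro κ' u'
    rw [SrecAt_eq_wilsonSecAt_add_bornSecAt, e3OfK_eq_e3K, e3OfK_eq_e3K, e3OfK_eq_e3K]
    exact e3K_add hG hδG Lc hW hB hδw hδb κ' u'
  funext κ' u'
  show SrecAt d Lc (toSite rr) cE cVH cΛ (j + 1) κ' u' - wilsonSecAt Lc (toSite rr) cE (j + 1) κ' u' = _
  rw [SrecAt_succ, wilsonSecAt_succ]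
  show (cE * wE d Lc (j + 1)) • e3OfK Lc (coDressKBmAt (toSite rr) Lc (KInvStep (d := d) Lc j)) (SrecAt d Lc (toSite rr) cE cVH cΛ j) κ' u' +
        (cVH * wVH d Lc (j + 1)) • vhSAt (toSite rr) d Lc rfl κ' u' +
        (cΛ * wΛ d Lc (j + 1)) •
          SLam Lc (lamCoeffK (KInvStep (d := d) Lc (j + 1)) (E2 d Lc (j + 1)) Lc) (fun μ y => hessFFAt (toSite rr) Lc μ y) κ' u'
      - (cE * wE d Lc (j + 1)) • e3OfK Lc (coDressKBmAt (toSite rr) Lc (KInvStep (d := d) Lc j)) (wilsonSecAt Lc (toSite rr) cE j) κ' u' = _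
  rw [hsplit κ' u', smul_add]
  abel

end Born

end Summit.QuantumFields.BalabanUV.Beta.GAN24.SrecWilsonSector

end
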